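import Summits.Ventures.LatticeQCDFlow.Scoring.PlaquetteVarianceWeakCoupling
import Summits.Ventures.LatticeQCDFlow.Scoring.UNCentreWardIdentity
import HarnessLib

/-!
# The adjoint plaquette of 2-d `U(N)` at weak coupling: `⟨|tr U_p|²⟩_β` in closed form and the one-loop law `β (1 − P_adj(β)) → N` — Casimir scaling is exact at one loop

HONEST FRAMING: exact (Metropolis-corrected) sampling algorithms for lattice gauge theory;
figures of merit are autocorrelation/cost numbers at stated couplings and volumes; no
continuum-physics claim.

Venture `LatticeQCDFlow` (cell pub-lqcd), sub-topic `Scoring`; FANOUT row 5 (`s0-sun-a`), GEN-20.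
NEW WORK of the cell (placement rule).  The character of the adjoint representation of `U(N)` is `|tr U|²` (dimension `N²`;
its non-trivial part `|tr U|² − 1` has dimension `N² − 1`).  Under the `U(N)` one-plaquette (= 2-d infinite-volume) law
`∝ e^{−β(N − Re tr U)} dU`, with `L = log det[I_{|i−j|}]` (`L′ = ⟨Re tr U⟩_β`, `L″ = Var_β(Re tr U)`, GEN-17) and the
`U(1)`-centre Ward identity `β⟨(Im tr U)²⟩_β = L′(β)` (`UNCentreWardIdentity`):

* §1 **`unitary_normSq_trace_law_eq`** — `⟨|tr U|²⟩_β = L″(β) + L′(β)² + L′(β)/β` for every `N ≥ 1`, `β ≠ 0`;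
* §2 **`tendsto_mul_sub_unitary_normSq_trace`** — `β (N² − ⟨|tr U_p|²⟩_β) → N³ − N` as `β → ∞` (GEN-20: `β(N − L′) → N²/2`,
  `β² L″ → N²/2`, `L′ → N`);
* §3 **`tendsto_mul_one_sub_unitary_adjoint_plaquette`** — with the adjoint plaquette
  `P_adj(β) = ⟨(|tr U_p|² − 1)⟩_β/(N² − 1)` (`N ≥ 2`): `β (1 − P_adj(β)) → N`.  With GEN-20's fundamental law
  `β(1 − P_N(β)) → N/2` the ratio of the one-loop coefficients is `2N²/(N² − 1) = C₂(adj)/C₂(fund)`: Casimir scaling of the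
  2-d plaquette holds exactly at one loop (`SU(2)`-like value `8/3` at `N = 2`).

No `def`, nothing cited as a fact, 0 sorry.
-/

noncomputable section

open Real MeasureTheory Filter Topology Finset
open Complex (I)
open ProbabilityTheory
open Literature.MathematicalPhysics.QuantumFieldTheory (haarProbability)
open Literature.Analysis.FunctionSpaces (besselI)

namespace Summit.Ventures.LatticeQCDFlow.Scoring

/-! ### 1. `⟨|tr U|²⟩_β` in closed form -/

/-- `‖tr U‖² = (Re tr U)² + (Im tr U)²`. -/
theorem norm_trace_sq_eq (N : ℕ) (u : Matrix.unitaryGroup (Fin N) ℂ) :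
    ‖((u : Matrix.unitaryGroup (Fin N) ℂ) : Matrix (Fin N) (Fin N) ℂ).trace‖ ^ 2 = ((u : Matrix.unitaryGroup (Fin N) ℂ) : Matrix (Fin N) (Fin N) ℂ).trace.re ^ 2 + ((u : Matrix.unitaryGroup (Fin N) ℂ) : Matrix (Fin N) (Fin N) ℂ).trace.im ^ 2 := by
  rw [Complex.sq_norm, Complex.normSq_apply]
  ring

/-- **`⟨|tr U|²⟩_β = L″(β) + L′(β)² + L′(β)/β`** (`L = log det[I_{|i−j|}]`, `N ≥ 1`, `β ≠ 0`): the second moment of `Re tr U` is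
`L″ + L′²` (tilted variance plus squared mean) and that of `Im tr U` is `L′/β` (the `U(1)`-centre Ward identity). -/
theorem unitary_normSq_trace_law_eq (N : ℕ) [NeZero N] {β : ℝ} (hβ : β ≠ 0) :
    (∫ u, ‖((u : Matrix.unitaryGroup (Fin N) ℂ) : Matrix (Fin N) (Fin N) ℂ).trace‖ ^ 2 * Real.exp (-(β * ((N : ℝ) - ((u : Matrix.unitaryGroup (Fin N) ℂ) : Matrix (Fin N) (Fin N) ℂ).trace.re))) ∂(haarProbability (Matrix.unitaryGroup (Fin N) ℂ))) / (∫ u, Real.exp (-(β * ((N : ℝ) - ((u : Matrix.unitaryGroup (Fin N) ℂ) : Matrix (Fin N) (Fin N) ℂ).trace.re))) ∂(haarProbability (Matrix.unitaryGroup (Fin N) ℂ)))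
      = iteratedDeriv 2 (fun y : ℝ => Real.log (Matrix.of fun i j : Fin N => besselI ((i : ℤ) - (j : ℤ)).natAbs y).det) β + deriv (fun y : ℝ => Real.log (Matrix.of fun i j : Fin N => besselI ((i : ℤ) - (j : ℤ)).natAbs y).det) β ^ 2 + deriv (fun y : ℝ => Real.log (Matrix.of fun i j : Fin N => besselI ((i : ℤ) - (j : ℤ)).natAbs y).det) β / β := by
  -- `⟨(Im tr)²⟩ = L′/β`
  have hJ := unitary_mul_trace_im_sq_eq_plaquette N β
  rw [unitary_plaquette_eq_deriv_log_det] at hJ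
  have hN : (N : ℝ) ≠ 0 := Nat.cast_ne_zero.2 (NeZero.ne N)
  have hJ' : (∫ u, ((u : Matrix.unitaryGroup (Fin N) ℂ) : Matrix (Fin N) (Fin N) ℂ).trace.im ^ 2 * Real.exp (-(β * ((N : ℝ) - ((u : Matrix.unitaryGroup (Fin N) ℂ) : Matrix (Fin N) (Fin N) ℂ).trace.re))) ∂(haarProbability (Matrix.unitaryGroup (Fin N) ℂ))) / (∫ u, Real.exp (-(β * ((N : ℝ) - ((u : Matrix.unitaryGroup (Fin N) ℂ) : Matrix (Fin N) (Fin N) ℂ).trace.re))) ∂(haarProbability (Matrix.unitaryGroup (Fin N) ℂ))) = deriv (fun y : ℝ => Real.log (Matrix.of fun i j : Fin N => besselI ((i : ℤ) - (j : ℤ)).natAbs y).det) β / β := by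
    field_simp at hJ ⊢
    linarith [hJ]
  -- `⟨(Re tr)²⟩ = L″ + L′²` via the variance identity of GEN-17
  have hV := unitary_plaquette_variance_eq N β
  rw [unitary_plaquette_eq_deriv_log_det] at hV
  have hR' : (∫ u, ((u : Matrix.unitaryGroup (Fin N) ℂ) : Matrix (Fin N) (Fin N) ℂ).trace.re ^ 2 * Real.exp (-(β * ((N : ℝ) - ((u : Matrix.unitaryGroup (Fin N) ℂ) : Matrix (Fin N) (Fin N) ℂ).trace.re))) ∂(haarProbability (Matrix.unitaryGroup (Fin N) ℂ))) / (∫ u, Real.exp (-(β * ((N : ℝ) - ((u : Matrix.unitaryGroup (Fin N) ℂ) : Matrix (Fin N) (Fin N) ℂ).trace.re))) ∂(haarProbability (Matrix.unitaryGroup (Fin N) ℂ)))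
      = iteratedDeriv 2 (fun y : ℝ => Real.log (Matrix.of fun i j : Fin N => besselI ((i : ℤ) - (j : ℤ)).natAbs y).det) β + deriv (fun y : ℝ => Real.log (Matrix.of fun i j : Fin N => besselI ((i : ℤ) - (j : ℤ)).natAbs y).det) β ^ 2 := by
    have e : ∀ u : Matrix.unitaryGroup (Fin N) ℂ, (((u : Matrix.unitaryGroup (Fin N) ℂ) : Matrix (Fin N) (Fin N) ℂ).trace.re / N) ^ 2 * Real.exp (-(β * ((N : ℝ) - ((u : Matrix.unitaryGroup (Fin N) ℂ) : Matrix (Fin N) (Fin N) ℂ).trace.re))) = 1 / N ^ 2 * (((u : Matrix.unitaryGroup (Fin N) ℂ) : Matrix (Fin N) (Fin N) ℂ).trace.re ^ 2 * Real.exp (-(β * ((N : ℝ) - ((u : Matrix.unitaryGroup (Fin N) ℂ) : Matrix (Fin N) (Fin N) ℂ).trace.re)))) := fun u => by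
      field_simp
    simp_rw [e] at hV
    rw [integral_const_mul] at hV
    field_simp at hV
    have hN2 : (N : ℝ) ^ 2 ≠ 0 := pow_ne_zero 2 hN
    have hZ : (∫ u, Real.exp (-(β * ((N : ℝ) - ((u : Matrix.unitaryGroup (Fin N) ℂ) : Matrix (Fin N) (Fin N) ℂ).trace.re))) ∂(haarProbability (Matrix.unitaryGroup (Fin N) ℂ))) ≠ 0 := by
      have hsplit : ∀ u : Matrix.unitaryGroup (Fin N) ℂ, Real.exp (-(β * ((N : ℝ) - ((u : Matrix.unitaryGroup (Fin N) ℂ) : Matrix (Fin N) (Fin N) ℂ).trace.re))) = Real.exp (-(N * β)) * Real.exp (β * ((u : Matrix.unitaryGroup (Fin N) ℂ) : Matrix (Fin N) (Fin N) ℂ).trace.re) := by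
        intro u; rw [← Real.exp_add]; congr 1; ring
      simp_rw [hsplit]
      rw [integral_const_mul, integral_haar_unitaryGroup_fin_exp_mul_trace_re]
      exact mul_ne_zero (Real.exp_pos _).ne' (det_besselI_toeplitz_fin_pos N β).ne'
    linarith [hV]
  -- assemble
  have hint1 : Integrable (fun u : Matrix.unitaryGroup (Fin N) ℂ => ((u : Matrix.unitaryGroup (Fin N) ℂ) : Matrix (Fin N) (Fin N) ℂ).trace.re ^ 2 * Real.exp (-(β * ((N : ℝ) - ((u : Matrix.unitaryGroup (Fin N) ℂ) : Matrix (Fin N) (Fin N) ℂ).trace.re)))) (haarProbability (Matrix.unitaryGroup (Fin N) ℂ)) := by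
    have hc : Continuous fun u : Matrix.unitaryGroup (Fin N) ℂ => ((u : Matrix.unitaryGroup (Fin N) ℂ) : Matrix (Fin N) (Fin N) ℂ).trace.re ^ 2 * Real.exp (-(β * ((N : ℝ) - ((u : Matrix.unitaryGroup (Fin N) ℂ) : Matrix (Fin N) (Fin N) ℂ).trace.re))) := by fun_prop
    refine Integrable.mono' (integrable_const (((N : ℝ) ^ 2) * Real.exp (|β| * (2 * N)))) hc.aestronglyMeasurable
      (Eventually.of_forall fun u => ?_)
    have hb : |((u : Matrix.unitaryGroup (Fin N) ℂ) : Matrix (Fin N) (Fin N) ℂ).trace.re| ≤ N := by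
      have h := abs_trace_re_le_card u
      rwa [Fintype.card_fin] at h
    rw [Real.norm_eq_abs, abs_mul, abs_pow, abs_of_nonneg (Real.exp_nonneg _)]
    refine mul_le_mul (pow_le_pow_left₀ (abs_nonneg _) hb 2) (Real.exp_le_exp.2 ?_) (Real.exp_nonneg _) (by positivity)
    calc -(β * ((N : ℝ) - ((u : Matrix.unitaryGroup (Fin N) ℂ) : Matrix (Fin N) (Fin N) ℂ).trace.re)) ≤ |-(β * ((N : ℝ) - ((u : Matrix.unitaryGroup (Fin N) ℂ) : Matrix (Fin N) (Fin N) ℂ).trace.re))| := le_abs_self _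
      _ = |β| * |(N : ℝ) - ((u : Matrix.unitaryGroup (Fin N) ℂ) : Matrix (Fin N) (Fin N) ℂ).trace.re| := by rw [abs_neg, abs_mul]
      _ ≤ |β| * (2 * N) := mul_le_mul_of_nonneg_left ?_ (abs_nonneg _)
    calc |(N : ℝ) - ((u : Matrix.unitaryGroup (Fin N) ℂ) : Matrix (Fin N) (Fin N) ℂ).trace.re| ≤ |(N : ℝ)| + |((u : Matrix.unitaryGroup (Fin N) ℂ) : Matrix (Fin N) (Fin N) ℂ).trace.re| := abs_sub _ _
      _ ≤ N + N := add_le_add (by rw [Nat.abs_cast]) hb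
      _ = 2 * N := by ring
  have hint2 : Integrable (fun u : Matrix.unitaryGroup (Fin N) ℂ => ((u : Matrix.unitaryGroup (Fin N) ℂ) : Matrix (Fin N) (Fin N) ℂ).trace.im ^ 2 * Real.exp (-(β * ((N : ℝ) - ((u : Matrix.unitaryGroup (Fin N) ℂ) : Matrix (Fin N) (Fin N) ℂ).trace.re)))) (haarProbability (Matrix.unitaryGroup (Fin N) ℂ)) := by
    have hc : Continuous fun u : Matrix.unitaryGroup (Fin N) ℂ => ((u : Matrix.unitaryGroup (Fin N) ℂ) : Matrix (Fin N) (Fin N) ℂ).trace.im ^ 2 * Real.exp (-(β * ((N : ℝ) - ((u : Matrix.unitaryGroup (Fin N) ℂ) : Matrix (Fin N) (Fin N) ℂ).trace.re))) := by fun_prop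
    refine Integrable.mono' (integrable_const (((N : ℝ) ^ 2) * Real.exp (|β| * (2 * N)))) hc.aestronglyMeasurable
      (Eventually.of_forall fun u => ?_)
    have hb : |((u : Matrix.unitaryGroup (Fin N) ℂ) : Matrix (Fin N) (Fin N) ℂ).trace.im| ≤ N := by
      have h := abs_trace_im_le_card u
      rwa [Fintype.card_fin] at h
    have hbR : |((u : Matrix.unitaryGroup (Fin N) ℂ) : Matrix (Fin N) (Fin N) ℂ).trace.re| ≤ N := by
      have h := abs_trace_re_le_card u
      rwa [Fintype.card_fin] at h
    rw [Real.norm_eq_abs, abs_mul, abs_pow, abs_of_nonneg (Real.exp_nonneg _)]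
    refine mul_le_mul (pow_le_pow_left₀ (abs_nonneg _) hb 2) (Real.exp_le_exp.2 ?_) (Real.exp_nonneg _) (by positivity)
    calc -(β * ((N : ℝ) - ((u : Matrix.unitaryGroup (Fin N) ℂ) : Matrix (Fin N) (Fin N) ℂ).trace.re)) ≤ |-(β * ((N : ℝ) - ((u : Matrix.unitaryGroup (Fin N) ℂ) : Matrix (Fin N) (Fin N) ℂ).trace.re))| := le_abs_self _
      _ = |β| * |(N : ℝ) - ((u : Matrix.unitaryGroup (Fin N) ℂ) : Matrix (Fin N) (Fin N) ℂ).trace.re| := by rw [abs_neg, abs_mul]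
      _ ≤ |β| * (2 * N) := mul_le_mul_of_nonneg_left ?_ (abs_nonneg _)
    calc |(N : ℝ) - ((u : Matrix.unitaryGroup (Fin N) ℂ) : Matrix (Fin N) (Fin N) ℂ).trace.re| ≤ |(N : ℝ)| + |((u : Matrix.unitaryGroup (Fin N) ℂ) : Matrix (Fin N) (Fin N) ℂ).trace.re| := abs_sub _ _
      _ ≤ N + N := add_le_add (by rw [Nat.abs_cast]) hbR
      _ = 2 * N := by ring
  have hsum : ∫ u, ‖((u : Matrix.unitaryGroup (Fin N) ℂ) : Matrix (Fin N) (Fin N) ℂ).trace‖ ^ 2 * Real.exp (-(β * ((N : ℝ) - ((u : Matrix.unitaryGroup (Fin N) ℂ) : Matrix (Fin N) (Fin N) ℂ).trace.re))) ∂(haarProbability (Matrix.unitaryGroup (Fin N) ℂ))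
      = (∫ u, ((u : Matrix.unitaryGroup (Fin N) ℂ) : Matrix (Fin N) (Fin N) ℂ).trace.re ^ 2 * Real.exp (-(β * ((N : ℝ) - ((u : Matrix.unitaryGroup (Fin N) ℂ) : Matrix (Fin N) (Fin N) ℂ).trace.re))) ∂(haarProbability (Matrix.unitaryGroup (Fin N) ℂ))) + ∫ u, ((u : Matrix.unitaryGroup (Fin N) ℂ) : Matrix (Fin N) (Fin N) ℂ).trace.im ^ 2 * Real.exp (-(β * ((N : ℝ) - ((u : Matrix.unitaryGroup (Fin N) ℂ) : Matrix (Fin N) (Fin N) ℂ).trace.re))) ∂(haarProbability (Matrix.unitaryGroup (Fin N) ℂ)) := by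
    rw [← integral_add hint1 hint2]
    refine integral_congr_ae (Eventually.of_forall fun u => ?_)
    simp only [norm_trace_sq_eq]
    ring
  rw [hsum, add_div, hR', hJ']

/-! ### 2. The one-loop law of `N² − ⟨|tr U|²⟩` -/

/-- **`β · (N² − ⟨|tr U_p|²⟩_β) → N³ − N`** as `β → ∞`, every `N ≥ 1`. -/
theorem tendsto_mul_sub_unitary_normSq_trace (N : ℕ) [NeZero N] :
    Tendsto (fun β : ℝ => β * ((N : ℝ) ^ 2 - (∫ u, ‖((u : Matrix.unitaryGroup (Fin N) ℂ) : Matrix (Fin N) (Fin N) ℂ).trace‖ ^ 2 * Real.exp (-(β * ((N : ℝ) - ((u : Matrix.unitaryGroup (Fin N) ℂ) : Matrix (Fin N) (Fin N) ℂ).trace.re))) ∂(haarProbability (Matrix.unitaryGroup (Fin N) ℂ))) / (∫ u, Real.exp (-(β * ((N : ℝ) - ((u : Matrix.unitaryGroup (Fin N) ℂ) : Matrix (Fin N) (Fin N) ℂ).trace.re))) ∂(haarProbability (Matrix.unitaryGroup (Fin N) ℂ))))) atTop (𝓝 ((N : ℝ) ^ 3 - N)) := by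
  have hB := tendsto_mul_sub_deriv_log_det_besselI_toeplitz N
  have hL1 := tendsto_deriv_log_det_besselI_toeplitz_atTop N
  have hL2 := tendsto_sq_mul_iteratedDeriv_two_log_det_besselI_toeplitz N
  -- `β L″(β) = (β² L″(β)) / β → 0`
  have hL2' : Tendsto (fun x : ℝ => x * iteratedDeriv 2 (fun y : ℝ => Real.log (Matrix.of fun i j : Fin N => besselI ((i : ℤ) - (j : ℤ)).natAbs y).det) x) atTop (𝓝 0) := by
    have h := hL2.mul tendsto_inv_atTop_zero
    rw [mul_zero] at h
    refine h.congr' ?_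
    filter_upwards [eventually_gt_atTop (0 : ℝ)] with x hx
    field_simp
  have hlim := ((hB.mul (hL1.const_add (N : ℝ))).sub hL2').sub hL1
  have hval : (N : ℝ) ^ 2 / 2 * ((N : ℝ) + N) - 0 - N = (N : ℝ) ^ 3 - N := by ring
  rw [hval] at hlim
  refine hlim.congr' ?_
  filter_upwards [eventually_gt_atTop (0 : ℝ)] with β hβ
  rw [unitary_normSq_trace_law_eq N hβ.ne']
  field_simp
  ring

/-! ### 3. The adjoint plaquette -/

/-- **THE ONE-LOOP LAW OF THE ADJOINT PLAQUETTE OF 2-d `U(N)`, EVERY `N ≥ 2`**: with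
`P_adj(β) = ⟨(|tr U_p|² − 1)⟩_β / (N² − 1)` (the normalised non-trivial part of the adjoint character) under the `U(N)`
one-plaquette law, `β · (1 − P_adj(β)) → N` as `β → ∞`.  Compared with the fundamental `β(1 − P_N(β)) → N/2` (GEN-20) the
one-loop coefficients are in the Casimir ratio `2N²/(N² − 1)`. -/
theorem tendsto_mul_one_sub_unitary_adjoint_plaquette (N : ℕ) [NeZero N] (hN : 2 ≤ N) :
    Tendsto (fun β : ℝ => β * (1 -
      (∫ u, (‖((u : Matrix.unitaryGroup (Fin N) ℂ) : Matrix (Fin N) (Fin N) ℂ).trace‖ ^ 2 - 1) * Real.exp (-(β * ((N : ℝ) - ((u : Matrix.unitaryGroup (Fin N) ℂ) : Matrix (Fin N) (Fin N) ℂ).trace.re))) ∂(haarProbability (Matrix.unitaryGroup (Fin N) ℂ))) / (∫ u, Real.exp (-(β * ((N : ℝ) - ((u : Matrix.unitaryGroup (Fin N) ℂ) : Matrix (Fin N) (Fin N) ℂ).trace.re))) ∂(haarProbability (Matrix.unitaryGroup (Fin N) ℂ))) / ((N : ℝ) ^ 2 - 1))) atTop (𝓝 (N : ℝ)) := by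
  have hN1 : (N : ℝ) ^ 2 - 1 ≠ 0 := by
    have h2 : (2 : ℝ) ≤ N := by exact_mod_cast hN
    nlinarith
  have h := (tendsto_mul_sub_unitary_normSq_trace N).div_const ((N : ℝ) ^ 2 - 1)
  rw [show ((N : ℝ) ^ 3 - N) / ((N : ℝ) ^ 2 - 1) = N by field_simp] at h
  refine h.congr' ?_
  filter_upwards [eventually_gt_atTop (0 : ℝ)] with β hβ
  -- `Z > 0` and `∫ (|tr|² − 1) w = ∫ |tr|² w − Z`
  have hsplit : ∀ u : Matrix.unitaryGroup (Fin N) ℂ, Real.exp (-(β * ((N : ℝ) - ((u : Matrix.unitaryGroup (Fin N) ℂ) : Matrix (Fin N) (Fin N) ℂ).trace.re))) = Real.exp (-(N * β)) * Real.exp (β * ((u : Matrix.unitaryGroup (Fin N) ℂ) : Matrix (Fin N) (Fin N) ℂ).trace.re) := by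
    intro u; rw [← Real.exp_add]; congr 1; ring
  have hZ : 0 < (∫ u, Real.exp (-(β * ((N : ℝ) - ((u : Matrix.unitaryGroup (Fin N) ℂ) : Matrix (Fin N) (Fin N) ℂ).trace.re))) ∂(haarProbability (Matrix.unitaryGroup (Fin N) ℂ))) := by
    simp_rw [hsplit]
    rw [integral_const_mul, integral_haar_unitaryGroup_fin_exp_mul_trace_re]
    exact mul_pos (Real.exp_pos _) (det_besselI_toeplitz_fin_pos N β)
  have hW : Integrable (fun u : Matrix.unitaryGroup (Fin N) ℂ => Real.exp (-(β * ((N : ℝ) - ((u : Matrix.unitaryGroup (Fin N) ℂ) : Matrix (Fin N) (Fin N) ℂ).trace.re)))) (haarProbability (Matrix.unitaryGroup (Fin N) ℂ)) := by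
    have hc : Continuous fun u : Matrix.unitaryGroup (Fin N) ℂ => Real.exp (-(β * ((N : ℝ) - ((u : Matrix.unitaryGroup (Fin N) ℂ) : Matrix (Fin N) (Fin N) ℂ).trace.re))) := by fun_prop
    refine Integrable.mono' (integrable_const (Real.exp (|β| * (2 * N)))) hc.aestronglyMeasurable
      (Eventually.of_forall fun u => ?_)
    have hb : |((u : Matrix.unitaryGroup (Fin N) ℂ) : Matrix (Fin N) (Fin N) ℂ).trace.re| ≤ N := by
      have h := abs_trace_re_le_card u
      rwa [Fintype.card_fin] at h
    rw [Real.norm_eq_abs, abs_of_nonneg (Real.exp_nonneg _)]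
    refine Real.exp_le_exp.2 ?_
    calc -(β * ((N : ℝ) - ((u : Matrix.unitaryGroup (Fin N) ℂ) : Matrix (Fin N) (Fin N) ℂ).trace.re)) ≤ |-(β * ((N : ℝ) - ((u : Matrix.unitaryGroup (Fin N) ℂ) : Matrix (Fin N) (Fin N) ℂ).trace.re))| := le_abs_self _
      _ = |β| * |(N : ℝ) - ((u : Matrix.unitaryGroup (Fin N) ℂ) : Matrix (Fin N) (Fin N) ℂ).trace.re| := by rw [abs_neg, abs_mul]
      _ ≤ |β| * (2 * N) := mul_le_mul_of_nonneg_left ?_ (abs_nonneg _)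
    calc |(N : ℝ) - ((u : Matrix.unitaryGroup (Fin N) ℂ) : Matrix (Fin N) (Fin N) ℂ).trace.re| ≤ |(N : ℝ)| + |((u : Matrix.unitaryGroup (Fin N) ℂ) : Matrix (Fin N) (Fin N) ℂ).trace.re| := abs_sub _ _
      _ ≤ N + N := add_le_add (by rw [Nat.abs_cast]) hb
      _ = 2 * N := by ring
  have hT : Integrable (fun u : Matrix.unitaryGroup (Fin N) ℂ => ‖((u : Matrix.unitaryGroup (Fin N) ℂ) : Matrix (Fin N) (Fin N) ℂ).trace‖ ^ 2 * Real.exp (-(β * ((N : ℝ) - ((u : Matrix.unitaryGroup (Fin N) ℂ) : Matrix (Fin N) (Fin N) ℂ).trace.re)))) (haarProbability (Matrix.unitaryGroup (Fin N) ℂ)) := by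
    have hc : Continuous fun u : Matrix.unitaryGroup (Fin N) ℂ => ‖((u : Matrix.unitaryGroup (Fin N) ℂ) : Matrix (Fin N) (Fin N) ℂ).trace‖ ^ 2 * Real.exp (-(β * ((N : ℝ) - ((u : Matrix.unitaryGroup (Fin N) ℂ) : Matrix (Fin N) (Fin N) ℂ).trace.re))) := by fun_prop
    refine Integrable.mono' ((hW.const_mul ((2 * (N : ℝ)) ^ 2))) hc.aestronglyMeasurable
      (Eventually.of_forall fun u => ?_)
    have hbR : |((u : Matrix.unitaryGroup (Fin N) ℂ) : Matrix (Fin N) (Fin N) ℂ).trace.re| ≤ N := by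
      have h := abs_trace_re_le_card u
      rwa [Fintype.card_fin] at h
    have hbI : |((u : Matrix.unitaryGroup (Fin N) ℂ) : Matrix (Fin N) (Fin N) ℂ).trace.im| ≤ N := by
      have h := abs_trace_im_le_card u
      rwa [Fintype.card_fin] at h
    rw [Real.norm_eq_abs, abs_mul, abs_of_nonneg (sq_nonneg _), abs_of_nonneg (Real.exp_nonneg _)]
    refine mul_le_mul_of_nonneg_right ?_ (Real.exp_nonneg _)
    rw [norm_trace_sq_eq]
    nlinarith [sq_abs ((u : Matrix.unitaryGroup (Fin N) ℂ) : Matrix (Fin N) (Fin N) ℂ).trace.re, sq_abs ((u : Matrix.unitaryGroup (Fin N) ℂ) : Matrix (Fin N) (Fin N) ℂ).trace.im, abs_nonneg ((u : Matrix.unitaryGroup (Fin N) ℂ) : Matrix (Fin N) (Fin N) ℂ).trace.re, abs_nonneg ((u : Matrix.unitaryGroup (Fin N) ℂ) : Matrix (Fin N) (Fin N) ℂ).trace.im]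
  have hnum : ∫ u, (‖((u : Matrix.unitaryGroup (Fin N) ℂ) : Matrix (Fin N) (Fin N) ℂ).trace‖ ^ 2 - 1) * Real.exp (-(β * ((N : ℝ) - ((u : Matrix.unitaryGroup (Fin N) ℂ) : Matrix (Fin N) (Fin N) ℂ).trace.re))) ∂(haarProbability (Matrix.unitaryGroup (Fin N) ℂ))
      = (∫ u, ‖((u : Matrix.unitaryGroup (Fin N) ℂ) : Matrix (Fin N) (Fin N) ℂ).trace‖ ^ 2 * Real.exp (-(β * ((N : ℝ) - ((u : Matrix.unitaryGroup (Fin N) ℂ) : Matrix (Fin N) (Fin N) ℂ).trace.re))) ∂(haarProbability (Matrix.unitaryGroup (Fin N) ℂ))) - (∫ u, Real.exp (-(β * ((N : ℝ) - ((u : Matrix.unitaryGroup (Fin N) ℂ) : Matrix (Fin N) (Fin N) ℂ).trace.re))) ∂(haarProbability (Matrix.unitaryGroup (Fin N) ℂ))) := by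
    rw [← integral_sub hT hW]
    refine integral_congr_ae (Eventually.of_forall fun u => ?_)
    ring
  rw [hnum]
  field_simp
  ring

end Summit.Ventures.LatticeQCDFlow.Scoring
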